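import Summits.QuantumFields.YangMills.Theses.SourcedPressureJensen
import Summits.QuantumFields.YangMills.Theorems.SourcedPressureJensenJensenFloorStubJensen
import Summits.QuantumFields.YangMills.Theorems.SourcedPressureJensenJensenFloorStubCentredSum
import HarnessLib

/-!
# `JensenFloor` (item stmt-QuantumFields-22518 of route `SourcedPressureJensen`) — PROVED, line `birth`

`Summit.QuantumFields.YangMills.Theses.SourcedPressureJensen.JensenFloor`: at every compact simple `G` and lattice representation `r`,
the sourced pressure increment bound (the body of the route's crux `SourcedPressureIncrement`: for `β ≥ β₀`, `1 ≤ n ≤ 2β^A`,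
`0 < h ≤ h₀`, eventually in the torus size, `|Λ|⁻¹ log E exp(−h H_{n,Λ}) ≤ −h σ C(n)² + C β^(−κ) + M h²` for the centred two-plaquette
source `H_{n,Λ} = Σ_x (β c(x) − β⟨c⟩)(β c(x + n e₀) − β⟨c⟩)`) implies the ONE-SIDED free-gluon law
`σ C(n)² − C′ β^(−κ′) ≤ β² (E[c₀ c_{n e₀}] − E[c₀] E[c_{n e₀}])` with `κ′ = κ/2`, `C′ = |C| + |M|`, `β₁ = max β₀ (max 1 (h₀^(−2/κ)))`.

Composition of the two registered stubs of the line `birth` (ideator ym-idea-3's BC3 skeleton), both landed: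
* `stub_jensen` (`Theorems/SourcedPressureJensenJensenFloorStubJensen.lean`): Jensen on the torus, `−h E[H] ≤ log E e^{−hH}`;
* `stub_centredSum` (`Theorems/SourcedPressureJensenJensenFloorStubCentredSum.lean`): `|Λ|⁻¹ E[H] = β² Cov_Λ(c₀, c_{n e₀})`;
with the optimisation `h := β^(−κ/2)` (`rpow_half_mul_half`, `rpow_half_le`) and real arithmetic.

HONEST LABEL: this is a rung-line item (the route's deciding theorem targets `WeakCouplingRates.XiPow`, an UPPER bound on the lattice
mass gap of torus-limit states at weak coupling); NOTHING here bears on the Clay Yang–Mills mass gap, which is NOT proved by this.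
The downstream support item `FloorOfLowerLaw` needs `8A < κ′ = κ/2`, i.e. `16A < κ` from the crux `SourcedPressureIncrement`.
-/

namespace Summit.QuantumFields.YangMills.Cruxes.JensenFloor.Birth

open MeasureTheory
open Literature.MathematicalPhysics.QuantumFieldTheory Literature.MathematicalPhysics.QuantumLattice
  Summit.QuantumFields.YangMills.Theorems.WeakCouplingRates

/-- Exponent bookkeeping: `β^(−κ/2) · β^(−κ/2) = β^(−κ)`. -/
theorem rpow_half_mul_half {β κ : ℝ} (hβ : 0 < β) : β ^ (-(κ / 2)) * β ^ (-(κ / 2)) = β ^ (-κ) := by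
  rw [← Real.rpow_add hβ]; ring_nf

/-- Threshold bookkeeping: for `β ≥ h₀^(−2/κ)` (`h₀, κ > 0`) one has `β^(−κ/2) ≤ h₀`. -/
theorem rpow_half_le {β κ h₀ : ℝ} (hκ : 0 < κ) (hh₀ : 0 < h₀) (hβ : h₀ ^ (-(2 / κ)) ≤ β) : β ^ (-(κ / 2)) ≤ h₀ := by
  have hB : 0 < h₀ ^ (-(2 / κ)) := Real.rpow_pos_of_pos hh₀ _
  have h1 : β ^ (-(κ / 2)) ≤ (h₀ ^ (-(2 / κ))) ^ (-(κ / 2)) :=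
    Real.rpow_le_rpow_of_nonpos hB hβ (by linarith)
  have h2 : (h₀ ^ (-(2 / κ))) ^ (-(κ / 2)) = h₀ := by
    rw [← Real.rpow_mul hh₀.le]
    have : -(2 / κ) * -(κ / 2) = 1 := by field_simp
    rw [this, Real.rpow_one]
  linarith [h1, h2.le, h2.ge]

/-- **`JensenFloor` holds** (item stmt-QuantumFields-22518): Jensen on the torus (`stub_jensen`) + translation invariance and centring
(`stub_centredSum`) turn the sourced pressure increment bound into the ONE-SIDED free-gluon law with `κ' = κ/2`, `C' = |C| + |M|`,
`β₁ = max β₀ (max 1 (h₀^(−2/κ)))`, at `h := β^(−κ/2)`.  A rung-line item below the summit; NOT the Clay mass gap. -/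
theorem JensenFloor_of :
    Summit.QuantumFields.YangMills.Theses.SourcedPressureJensen.JensenFloor := by
  intro G _ _ _ _ _
  letI : MeasurableSpace G := borel G
  haveI : BorelSpace G := ⟨rfl⟩
  intro r hKS
  obtain ⟨κ, A, M, C, σ, h₀, β₀, hκ, hA, hσ, hh₀, hmain⟩ := hKS
  refine ⟨κ / 2, A, |C| + |M|, σ, max β₀ (max 1 (h₀ ^ (-(2 / κ)))), by positivity, hA, hσ, ?_⟩
  intro β hβ n hn1 hn2
  have hβ₀ : β₀ ≤ β := le_trans (le_max_left _ _) hβ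
  have hβ1 : (1 : ℝ) ≤ β := le_trans (le_trans (le_max_left _ _) (le_max_right _ _)) hβ
  have hβB : h₀ ^ (-(2 / κ)) ≤ β := le_trans (le_trans (le_max_right _ _) (le_max_right _ _)) hβ
  have hβpos : 0 < β := by linarith
  have hpos : 0 < β ^ (-(κ / 2)) := Real.rpow_pos_of_pos hβpos _
  have hle : β ^ (-(κ / 2)) ≤ h₀ := rpow_half_le hκ hh₀ hβB
  have hsq : β ^ (-(κ / 2)) * β ^ (-(κ / 2)) = β ^ (-κ) := rpow_half_mul_half hβpos
  have ev := hmain β hβ₀ n hn1 hn2 (β ^ (-(κ / 2))) hpos hle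
  filter_upwards [ev] with L hL
  have j := stub_jensen G r β n (β ^ (-(κ / 2))) L
  have c := stub_centredSum G r β n L
  -- abbreviate the three real numbers in play
  generalize hE : wilsonExpectation (L := L + 1) r.ρ β (fun U =>
              ∑ x : Fin 4 → Fin (L + 1),
                toTorusObservable (L + 1)
                  (fun V =>
                    (β * plaqCost0 (d := 4) r.ρ 1 2 (configShift (fun i => -((x i : ℕ) : ℤ)) V) -
                        β * wilsonExpectation (L := L + 1) r.ρ β
                          (toTorusObservable (L + 1) (plaqCost0 (d := 4) r.ρ 1 2))) *
                      (β * plaqCost0 (d := 4) r.ρ 1 2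
                          (timeShiftLG (G := G) n (configShift (fun i => -((x i : ℕ) : ℤ)) V)) -
                        β * wilsonExpectation (L := L + 1) r.ρ β
                          (toTorusObservable (L + 1) (plaqCost0 (d := 4) r.ρ 1 2))))
                  U) = E at j c
  generalize hP : Real.log
            (wilsonExpectation (L := L + 1) r.ρ β fun U =>
              Real.exp
                (-(β ^ (-(κ / 2))) *
                  ∑ x : Fin 4 → Fin (L + 1),
                    toTorusObservable (L + 1)
                      (fun V =>
                        (β * plaqCost0 (d := 4) r.ρ 1 2 (configShift (fun i => -((x i : ℕ) : ℤ)) V) -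
                            β * wilsonExpectation (L := L + 1) r.ρ β
                              (toTorusObservable (L + 1) (plaqCost0 (d := 4) r.ρ 1 2))) *
                          (β * plaqCost0 (d := 4) r.ρ 1 2
                              (timeShiftLG (G := G) n (configShift (fun i => -((x i : ℕ) : ℤ)) V)) -
                            β * wilsonExpectation (L := L + 1) r.ρ β
                              (toTorusObservable (L + 1) (plaqCost0 (d := 4) r.ρ 1 2))))
                      U)) = P at j hL
  generalize hX : (wilsonExpectation (L := L + 1) r.ρ β
                (toTorusObservable (L + 1) fun U =>
                  plaqCost0 (d := 4) r.ρ 1 2 U * plaqCost0 (d := 4) r.ρ 1 2 (timeShiftLG (G := G) n U)) -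
              wilsonExpectation (L := L + 1) r.ρ β (toTorusObservable (L + 1) (plaqCost0 (d := 4) r.ρ 1 2)) *
                wilsonExpectation (L := L + 1) r.ρ β
                  (toTorusObservable (L + 1) fun U => plaqCost0 (d := 4) r.ρ 1 2 (timeShiftLG (G := G) n U))) = X at c ⊢
  generalize hS : (curvaturePlaquetteCorr (d := 4) (by norm_num) (n : ℤ)) ^ 2 = S at hL ⊢
  generalize hh : β ^ (-(κ / 2)) = η at hpos hle hsq j hL ⊢
  -- now pure real arithmetic: hL : V⁻¹ * P ≤ -η σ S + C β^{-κ} + M η², j : -η E ≤ P, c : V⁻¹ E = β² X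
  have hV : (0 : ℝ) < ((L + 1 : ℝ) ^ 4)⁻¹ := by positivity
  have j' : ((L + 1 : ℝ) ^ 4)⁻¹ * (-η * E) ≤ ((L + 1 : ℝ) ^ 4)⁻¹ * P := mul_le_mul_of_nonneg_left j hV.le
  have key : -η * (β ^ 2 * X) ≤ -η * (σ * S) + C * (η * η) + M * η ^ 2 := by
    have : ((L + 1 : ℝ) ^ 4)⁻¹ * (-η * E) = -η * (β ^ 2 * X) := by rw [← c]; ring
    rw [← hsq] at hL
    linarith
  have key2 : η * (σ * S - (C + M) * η) ≤ η * (β ^ 2 * X) := by nlinarith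
  have key3 : σ * S - (C + M) * η ≤ β ^ 2 * X := le_of_mul_le_mul_left key2 hpos
  have hCM : (C + M) * η ≤ (|C| + |M|) * η := by
    apply mul_le_mul_of_nonneg_right _ hpos.le
    linarith [le_abs_self C, le_abs_self M]
  linarith

end Summit.QuantumFields.YangMills.Cruxes.JensenFloor.Birth
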